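import Literature.MathematicalPhysics.QuantumFieldTheory.Balaban1983to89.B1Ineq36LowerStep
import Literature.MathematicalPhysics.QuantumFieldTheory.Balaban1983to89.B1RTSemigroup
import Literature.MathematicalPhysics.QuantumFieldTheory.Balaban1983to89.HiggsCovarianceCont

/-!
# `Balaban1983to89.HiggsDoubleRT` — T. Bałaban, *(Higgs)₂,₃ quantum fields in a finite volume. I. A lower bound*,
Commun. Math. Phys. **85** (1982) 603–626 [Balaban1982Higgs1], pp. 608–609, 613, 618: the DOUBLE renormalization
transformation `T^{L^kε}_{a,L}[T^{L^kε}_{a,L,Ã}[ρ]]` of the model at every level `k` — the scalar-field transformation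
(2.4)–(2.7) at an external `ε`-lattice vector field `Ã = Ã(A)` followed by the vector-field transformation (p. 608:
*"taking N = d and an external vector field A = 0"*) — over the concrete carriers `…HiggsLattice` / `…HiggsAveraging` /
`…B1RT` / `…B3MultiscaleFields`, with its printed properties PROVED: normalization (2.8), integral preservation (2.9),
positivity, integrability, and the cut-off insertion that (3.6) p. 613 and (3.37) p. 618 consist of

statement-level skeleton of published theorems with citation tags; proofs where landed; nothing here is a claim about the Yang–Mills mass gap

PDF held: `paper:balaban1982-cmp85-higgs23-i` (journal page = PDF page + 602).  Displays read from the ×2 renders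
`run/shared/lean/pub/pub-balaban/b2b-balaban-ref1/pages/1982-cmp85-higgs23-I/…-p006-x2.png`, `…-p007-x2.png` (pp. 608–609),
`…-p011-x2.png` (p. 613), `…-p016-x2.png` (p. 618), never from the OCR layer.

CITATION HEADER (lean-in-tree rule).  lit-balaban typed skeleton (HOME `run/shared/lean/pub/lit-balaban/`), typer line
(carrier API; rows of record unchanged): rows **B1.Eq2.4 / B1.Eq2.8 / B1.Eq2.9** (owner r14: `B1RT`, `HiggsAveraging`),
**B1.Eq3.6** (r14: mechanism `B1Ineq36LowerStep.integral_cutoff_double_cutoff_le`), **B1.Eq3.37-3.38** (r12; abstract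
(3.37) = p14's `B1Ineq337Proof.ineq337`).  WHAT IS REPRODUCED.  p. 608, verbatim: *"Let us define the renormalization
transformation T^{L^kη}_{a,L,A} … ρ′(A,ψ) = (T^{L^kη}_{a,L,A}ρ)(A,ψ) = ∫dφ t^{L^kη}_{a,L,A}(Ω;ψ,φ)ρ(A,φ), (2.4)"* with the
kernel (2.5)–(2.6) and the average (2.7) — the tree's `HiggsAveraging.rtKernelStep C a Ã` / `renormTransf` at an external
field `Ã : VecField P 0`; *"The renormalization transformations for vector fields will be obtained by taking N = d and an
external vector field A = 0"* — HERE LITERALLY: the vector-field kernel `vecKernel a B A` IS `rtKernelStep` with `N = d`,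
external field `0` (all transports `U(0) = 1`, `HiggsLattice.ChargeData.U_zero`; the charge matrix is then immaterial and
we take `B3MultiscaleFields.zeroCharge d`), evaluated on the site functions `x ↦ (B_μ(x))_μ`, `x ↦ (A_μ(x))_μ`
(`B3MultiscaleFields.toSite`); p. 609: *"∫dψ t(Ω;ψ,φ) = 1, (2.8) hence … ∫dψ ρ′(A,ψ) = ∫dφ ρ(A,φ). (2.9)"*.  The double
transformation `doubleRTk C a ext ρ (B, ψ) = ∫dA t_{a,L}(B, A) ∫dφ t_{a,L,Ã(A)}(ψ, φ) ρ(A, φ)` is the composite appearing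
in (3.6) p. 613 (`k = 0`, `Ã(A) = A`: `T^ε_{a,L}[T^ε_{a,L,A}[·]]`) and in (3.37) p. 618 (`Ã(A) = A^{(k),ε}` of (3.29):
`T^{L^kε}_{a,L}[T^{L^kε}_{a,L,A^{(k),ε}}[·]]`); `ext : VecField P k → VecField P 0` ↤ the assignment `A ↦ Ã(A)`, assumed
measurable only.  `∫dA`, `∫dφ`, `∫dB`, `∫dψ` = product Lebesgue measures (p. 605).
PROVED, in this order: (§1) currying `(ι × κ → X) ≃ (ι → κ → X)` preserves product Lebesgue measure (generic); (§2) the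
p. 608 device as a CHANGE OF VARIABLES: `toSite` is a measurable equivalence `VecField P k ≃ᵐ ScalarField P k d` carrying
`dA` to the Lebesgue measure on `ℝ^d`-valued site functions (`measurePreserving_toSite`, `integral_comp_toSite`); (§3)
joint continuity of `(Ã, φ) ↦ Q(Ã)φ` (2.7) and of the kernel (2.5)–(2.6) in `(Ã; ψ, φ)`; `Q(0)` = the plain block average;
(§4) the kernels are bounded; (§5) the vector-field kernel: `≥ 0`, bounded, jointly continuous, **(2.8)** `∫dB t(B, A) = 1`
(`integral_vecKernel`, by §2 from `HiggsAveraging.integral_rtKernelStep` with `N = d`); (§6) the double transformation: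
iterated = one-product-kernel form (Fubini, `B1Ineq36LowerStep.doubleKernel`), **(2.9)** `∫dB∫dψ T[T[ρ]] = ∫dA∫dφ ρ`
(`integral_doubleRTk`), `T[T[ρ]] ≥ 0` for `ρ ≥ 0`, integrable for `ρ` integrable, and the two cut-off insertions:
`∫dB∫dψ χ′·T[T[ρ]] ≤ ∫dA∫dφ ρ` for `0 ≤ χ′ ≤ 1` (`integral_cutoff_doubleRTk_le`, the step *"(2.9) ⇒ (3.37)"*) and
`∫dB∫dψ χ₁·T[T[χ₀ρ]] ≤ ∫dA∫dφ ρ` (`lowerStepK`, the shape of (3.6), = r14's mechanism with all eight kernel hypotheses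
discharged).  The level-`0` instance with `Ã(A) = A` and `ρ = exp(−S^ε)` ((3.6) itself, `Z^ε` on the right) and the
level-`k` instance with `Ã(A) = A^{(k),ε}` and the printed `χ_k`, `χ_{k+1}` ((3.37)) are separate files
(`B1Ineq36HiggsModel`, `B1Ineq337HiggsModel`).
DELIBERATELY NOT HERE: the composition law (2.12)–(2.15) of the transformations (rows B1.Eq2.12/2.14, r14/r12); the
rescaling (3.38); effective actions.
Unit `lit-balaban-typer` gen 3 (literature-prover-lit-balaban-typer-g3-0); HOME/FILED.md records the proposal.
-/

open scoped BigOperators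
open _root_.MeasureTheory _root_.Real

namespace Literature.MathematicalPhysics.QuantumFieldTheory.Balaban1983to89.HiggsDoubleRT

open Literature.MathematicalPhysics.QuantumFieldTheory.Balaban1983to89.HiggsLattice
open Literature.MathematicalPhysics.QuantumFieldTheory.Balaban1983to89.HiggsAveraging
open Literature.MathematicalPhysics.QuantumFieldTheory.Balaban1983to89.B1RT
open Literature.MathematicalPhysics.QuantumFieldTheory.Balaban1983to89.B1Ineq36LowerStep
open Literature.MathematicalPhysics.QuantumFieldTheory.Balaban1983to89.B1RTSemigroup (rtKernel_le)
open Literature.MathematicalPhysics.QuantumFieldTheory.Balaban1983to89.B3MultiscaleFields (toSite zeroCharge zeroCharge_U)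
open Literature.MathematicalPhysics.QuantumFieldTheory.Balaban1983to89.B1Eq31Concrete (continuous_chargeU continuous_toSite)
open Literature.MathematicalPhysics.QuantumFieldTheory.Balaban1983to89.HiggsCovarianceCont (continuous_contourSum)

/-! ## 1. Currying preserves product Lebesgue measure (generic) -/

section Curry

variable (ι κ X : Type*) [Fintype ι] [Fintype κ] [MeasureSpace X] [SigmaFinite (volume : Measure X)]

/-- Uncurrying `(ι → κ → X) → (ι × κ → X)` carries the product (over `ι`) of the product (over `κ`) Lebesgue measures
to the product Lebesgue measure over `ι × κ` (both are determined by their values on boxes).  Generic measure plumbing;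
the same statement (for `X = ℝ`) is proved independently in `…QuantumFieldTheory.LatticeMaxwellFreeEnergyLimit` and in
`Literature.Barriers.CriticalPhenomena.RigorousRGSmallParameterGaussianIntegration` — not imported here to keep the
(Higgs)₂,₃ cone free of those modules. [folklore] -/
private theorem volume_preserving_curry_symm : MeasurePreserving (MeasurableEquiv.curry ι κ X).symm volume volume := by
  refine ⟨(MeasurableEquiv.curry ι κ X).symm.measurable, ?_⟩
  change _ = Measure.pi fun _ : ι × κ => (volume : Measure X)
  refine (Measure.pi_eq fun t ht => ?_).symm
  rw [Measure.map_apply (MeasurableEquiv.curry ι κ X).symm.measurable (MeasurableSet.univ_pi ht)]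
  have hpre : ((MeasurableEquiv.curry ι κ X).symm : (ι → κ → X) → ι × κ → X) ⁻¹' Set.pi Set.univ t
      = Set.pi Set.univ fun i => Set.pi Set.univ fun j => t (i, j) := by
    ext f
    simp only [MeasurableEquiv.coe_curry_symm, Set.mem_preimage, Set.mem_univ_pi, Prod.forall,
      Function.uncurry_apply_pair]
  rw [hpre, volume_pi_pi]
  simp_rw [volume_pi_pi]
  exact (Fintype.prod_prod_type (f := fun p : ι × κ => (volume : Measure X) (t p))).symm

/-- Currying `(ι × κ → X) → (ι → κ → X)` preserves product Lebesgue measure. [folklore] -/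
private theorem volume_preserving_curry : MeasurePreserving (MeasurableEquiv.curry ι κ X) volume volume := by
  simpa only [MeasurableEquiv.symm_symm] using
    (volume_preserving_curry_symm ι κ X).symm (MeasurableEquiv.curry ι κ X).symm

end Curry

variable {P : Params}

/-! ## 2. p. 608: vector fields as `ℝ^d`-valued site functions — a measure-preserving change of variables -/

section ToSite

variable {k : ℕ}

/-- A bond `⟨x, x + ηe_μ⟩` is the pair `(x, μ)` (p. 604) — for the (Higgs)₂,₃ carrier `HiggsLattice.PBond` (the YM
substrate's analogue is `LatticeFieldCalculus.bondEquiv` over `Setup`'s tori; different types). [cite: Balaban1982Higgs1, (1.4) p.604] -/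
def bondProdEquiv (P : Params) (k : ℕ) : PBond P k ≃ Site P k × Fin P.d :=
  ⟨fun b => (b.src, b.dir), fun p => ⟨p.1, p.2⟩, fun _ => rfl, fun _ => rfl⟩

/-- The identification `A ↦ (x ↦ (A_μ(x))_μ)` of p. 608 (*"taking N = d"*) as a MEASURABLE EQUIVALENCE between vector
fields (functions on bonds) and `ℝ^d`-valued site functions: relabel bonds as pairs, curry, and pass to `ℝ^d = PiLp 2`
coordinatewise. [cite: Balaban1982Higgs1, p.608] -/
def toSiteEquiv (P : Params) (k : ℕ) : VecField P k ≃ᵐ ScalarField P k P.d :=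
  ((MeasurableEquiv.piCongrLeft (fun _ : Site P k × Fin P.d => ℝ) (bondProdEquiv P k)).trans
      (MeasurableEquiv.curry (Site P k) (Fin P.d) ℝ)).trans
    (MeasurableEquiv.piCongrRight fun _ : Site P k => MeasurableEquiv.toLp 2 (Fin P.d → ℝ))

/-- The measurable equivalence IS the tree's `B3MultiscaleFields.toSite`. [cite: Balaban1982Higgs1, p.608] -/
theorem toSiteEquiv_apply (A : VecField P k) : toSiteEquiv P k A = toSite A := by
  funext x
  change WithLp.toLp 2 (fun μ : Fin P.d =>
      MeasurableEquiv.piCongrLeft (fun _ : Site P k × Fin P.d => ℝ) (bondProdEquiv P k) A (bondProdEquiv P k ⟨x, μ⟩)) = _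
  simp only [MeasurableEquiv.coe_piCongrLeft, Equiv.piCongrLeft_apply_apply]
  rfl

/-- `toSite` as a function is the measurable equivalence. [cite: Balaban1982Higgs1, p.608] -/
theorem coe_toSiteEquiv : ⇑(toSiteEquiv P k) = (toSite : VecField P k → ScalarField P k P.d) :=
  funext toSiteEquiv_apply

/-- **The p. 608 device as a change of variables**: `A ↦ (x ↦ (A_μ(x))_μ)` carries the Lebesgue measure `dA` on vector
fields (product over bonds, p. 605) to the Lebesgue measure on `ℝ^d`-valued site functions (product over sites of
Lebesgue measure on `ℝ^d`). PROVED (bond relabeling: `volume_measurePreserving_piCongrLeft`; currying: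
a private currying lemma; `ℝ^d` coordinates: `PiLp.volume_preserving_toLp`). [cite: Balaban1982Higgs1, p.608] -/
theorem measurePreserving_toSiteEquiv : MeasurePreserving (toSiteEquiv P k) volume volume := by
  have h1 : MeasurePreserving (MeasurableEquiv.piCongrLeft (fun _ : Site P k × Fin P.d => ℝ) (bondProdEquiv P k))
      volume volume :=
    volume_measurePreserving_piCongrLeft (fun _ : Site P k × Fin P.d => ℝ) (bondProdEquiv P k)
  have h2 : MeasurePreserving (MeasurableEquiv.curry (Site P k) (Fin P.d) ℝ) volume volume :=
    volume_preserving_curry (Site P k) (Fin P.d) ℝ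
  have h3 : MeasurePreserving
      (MeasurableEquiv.piCongrRight fun _ : Site P k => MeasurableEquiv.toLp 2 (Fin P.d → ℝ)) volume volume :=
    volume_preserving_pi fun _ : Site P k => PiLp.volume_preserving_toLp (Fin P.d)
  exact h3.comp (h2.comp h1)

/-- The same for the tree's function `toSite`. [cite: Balaban1982Higgs1, p.608] -/
theorem measurePreserving_toSite :
    MeasurePreserving (toSite : VecField P k → ScalarField P k P.d) volume volume := by
  rw [← coe_toSiteEquiv]
  exact measurePreserving_toSiteEquiv

/-- Change of variables in integrals over vector fields: `∫dA F((A_μ(·))_μ) = ∫df F(f)` over `ℝ^d`-valued site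
functions — the sentence of p. 608 that the vector-field transformations need not be considered separately, at the
level of the integrals (2.4)/(2.8)/(2.9). PROVED. [cite: Balaban1982Higgs1, p.608] -/
theorem integral_comp_toSite {E : Type*} [NormedAddCommGroup E] [NormedSpace ℝ E] (F : ScalarField P k P.d → E) :
    ∫ A : VecField P k, F (toSite A) = ∫ f : ScalarField P k P.d, F f := by
  simp_rw [← toSiteEquiv_apply]
  exact measurePreserving_toSiteEquiv.integral_comp' F

end ToSite

/-! ## 3. Joint continuity of the averaging operator (2.7) and of the kernel (2.5)–(2.6); `Q(0)` -/

section Continuity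

variable {k N : ℕ}

/-- **`(Ã, φ) ↦ Q(Ã)φ` (2.7) is jointly continuous** in the external field and the averaged field (needed for the joint
measurability of the kernel (2.5)–(2.6) in `(Ã; ψ, φ)`). [cite: Balaban1982Higgs1, (2.7) p.608] -/
theorem continuous_avgQ (C : ChargeData N) :
    Continuous fun p : VecField P 0 × ScalarField P k N => avgQ C p.1 p.2 := by
  refine continuous_pi fun y => ?_
  simp only [avgQ_apply]
  have hφ : ∀ x : Site P k, Continuous fun p : VecField P 0 × ScalarField P k N => p.2 x :=
    fun x => (continuous_apply x).comp continuous_snd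
  have hterm : ∀ x : Site P k, Continuous fun p : VecField P 0 × ScalarField P k N =>
      C.U (P.mesh 0) (contourSum p.1 (toFinest y) (toFinest x)) (p.2 x) := fun x =>
    ((continuous_chargeU C (P.mesh 0)).comp ((continuous_contourSum _ _).comp continuous_fst)).clm_apply (hφ x)
  have hsum : Continuous fun p : VecField P 0 × ScalarField P k N =>
      ∑ x ∈ block y, C.U (P.mesh 0) (contourSum p.1 (toFinest y) (toFinest x)) (p.2 x) :=
    continuous_finsetSum _ fun x _ => hterm x
  exact hsum.const_smul (((P.L : ℝ) ^ P.d)⁻¹)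

/-- Curried form: `t ↦ Q(Ã(t))φ(t)` is continuous along continuous families. [cite: Balaban1982Higgs1, (2.7) p.608] -/
theorem continuous_avgQ_comp {X : Type*} [TopologicalSpace X] (C : ChargeData N) {A : X → VecField P 0}
    {φ : X → ScalarField P k N} (hA : Continuous A) (hφ : Continuous φ) :
    Continuous fun t => avgQ C (A t) (φ t) := by
  have h := (continuous_avgQ (P := P) (k := k) C).comp (hA.prodMk hφ)
  exact h

/-- **The kernel (2.5)–(2.6) `t^{L^kε}_{a,L,Ã}(ψ, φ)` of the model is jointly continuous in `(Ã; ψ, φ)`** (a finite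
product of Gaussians of continuous expressions). [cite: Balaban1982Higgs1, (2.6) p.608] -/
theorem continuous_rtKernelStep (C : ChargeData N) (a : ℝ) :
    Continuous fun p : VecField P 0 × ScalarField P (k + 1) N × ScalarField P k N =>
      rtKernelStep C a p.1 p.2.1 p.2.2 := by
  have hQ : Continuous fun p : VecField P 0 × ScalarField P (k + 1) N × ScalarField P k N =>
      avgQ (k := k) C p.1 p.2.2 :=
    continuous_avgQ_comp C continuous_fst (continuous_snd.comp continuous_snd)
  have hy : ∀ y : Site P (k + 1), Continuous fun p : VecField P 0 × ScalarField P (k + 1) N × ScalarField P k N =>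
      rtKernel (prec a (P.mesh (k + 1)) P.d) (p.2.1 y - avgQ (k := k) C p.1 p.2.2 y) := by
    intro y
    have h1 : Continuous fun p : VecField P 0 × ScalarField P (k + 1) N × ScalarField P k N => p.2.1 y :=
      (continuous_apply y).comp (continuous_fst.comp continuous_snd)
    have h2 : Continuous fun p : VecField P 0 × ScalarField P (k + 1) N × ScalarField P k N =>
        avgQ (k := k) C p.1 p.2.2 y := (continuous_apply y).comp hQ
    exact (continuous_rtKernel (prec a (P.mesh (k + 1)) P.d)).comp (h1.sub h2)
  have h := continuous_finsetProd (Finset.univ : Finset (Site P (k + 1))) fun y _ => hy y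
  exact h

/-- Curried form: `t ↦ t_{a,L,Ã(t)}(ψ(t), φ(t))` is continuous along continuous families. [cite: Balaban1982Higgs1, (2.6) p.608] -/
theorem continuous_rtKernelStep_comp {X : Type*} [TopologicalSpace X] (C : ChargeData N) (a : ℝ)
    {A : X → VecField P 0} {ψ : X → ScalarField P (k + 1) N} {φ : X → ScalarField P k N} (hA : Continuous A)
    (hψ : Continuous ψ) (hφ : Continuous φ) : Continuous fun t => rtKernelStep C a (A t) (ψ t) (φ t) := by
  have h := (continuous_rtKernelStep (P := P) (k := k) C a).comp (hA.prodMk (hψ.prodMk hφ))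
  exact h

/-- The kernel is jointly MEASURABLE in `(A; ψ, φ)` when the external field is any measurable function `Ã(A)` of the
integrated field. [cite: Balaban1982Higgs1, (2.6) p.608] -/
theorem measurable_rtKernelStep_ext (C : ChargeData N) (a : ℝ) {ext : VecField P k → VecField P 0}
    (hext : Measurable ext) :
    Measurable fun p : VecField P k × ScalarField P (k + 1) N × ScalarField P k N =>
      rtKernelStep C a (ext p.1) p.2.1 p.2.2 := by
  have h := (continuous_rtKernelStep (P := P) (k := k) C a).measurable.comp
    ((hext.comp measurable_fst).prodMk measurable_snd)
  exact h

/-- **`Q(0)` is the plain block average**: `(Q(0)φ)(y) = L^{−d} Σ_{x ∈ B(y)} φ(x)` (`U(0) = 1`, p. 605) — the sense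
of *"taking … an external vector field A = 0"* on p. 608; in particular it does not depend on the charge matrix.
[cite: Balaban1982Higgs1, (2.7) p.608] -/
theorem avgQ_zero_apply (C : ChargeData N) (φ : ScalarField P k N) (y : Site P (k + 1)) :
    avgQ C (0 : VecField P 0) φ y = (((P.L : ℝ) ^ P.d)⁻¹) • ∑ x ∈ block y, φ x := by
  rw [avgQ_apply]
  congr 1
  refine Finset.sum_congr rfl fun x _ => ?_
  rw [show contourSum (0 : VecField P 0) (toFinest y) (toFinest x) = 0 by simp [contourSum, segSum],
    ChargeData.U_zero]
  rfl

end Continuity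

/-! ## 4. The block kernel (2.5) is bounded -/

section KernelBounds

variable {V : Type*} [NormedAddCommGroup V] [InnerProductSpace ℝ V]
variable {X Y : Type*} [Fintype Y]

/-- The block kernel (2.5) is bounded: `t(Ω; ψ, φ) ≤ ((κ/2π)^{N/2})^{|Ω'|}` (sitewise `t_κ(v) ≤ (κ/2π)^{N/2}`,
r14's `B1RTSemigroup.rtKernel_le`). [cite: Balaban1982Higgs1, (2.5) p.608] -/
theorem blockKernel_le {κ : ℝ} (hκ : 0 ≤ κ) (m : (X → V) → Y → V) (ψ : Y → V) (φ : X → V) :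
    blockKernel κ m ψ φ ≤ ((κ / (2 * π)) ^ ((Module.finrank ℝ V : ℝ) / 2)) ^ Fintype.card Y := by
  rw [blockKernel_eq, ← Finset.card_univ, ← Finset.prod_const]
  exact Finset.prod_le_prod (fun y _ => rtKernel_nonneg hκ _) fun y _ => rtKernel_le hκ _

end KernelBounds

/-! ## 5. The kernels of the two one-step transformations at level `k` -/

section Kernels

variable {k N : ℕ}

/-- The precision `κ = a(L^{k+1}ε)^{d−2}` of the one-step kernels at level `k` (p. 608) is positive for `a > 0`.
[cite: Balaban1982Higgs1, (2.6) p.608] -/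
theorem prec_step_pos {a : ℝ} (ha : 0 < a) : 0 < prec a (P.mesh (k + 1)) P.d :=
  prec_pos ha (P.mesh_pos (k + 1)) P.d

/-- The bound `((κ/2π)^{N/2})^{|T^{(k+1)}|}` of a level-`k` one-step block kernel with `N`-component fields.
[cite: Balaban1982Higgs1, (2.5) p.608] -/
noncomputable def kernelBound (P : Params) (k N : ℕ) (a : ℝ) : ℝ :=
  ((prec a (P.mesh (k + 1)) P.d / (2 * π)) ^ ((N : ℝ) / 2)) ^ Fintype.card (Site P (k + 1))

/-- The kernel bound is non-negative (`a > 0`). [cite: Balaban1982Higgs1, (2.5) p.608] -/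
theorem kernelBound_nonneg (N : ℕ) {a : ℝ} (ha : 0 < a) : 0 ≤ kernelBound P k N a :=
  pow_nonneg (Real.rpow_nonneg (div_nonneg (prec_step_pos (P := P) (k := k) ha).le (by positivity)) _) _

/-- The scalar-field kernel (2.5)–(2.6) is non-negative. [cite: Balaban1982Higgs1, (2.6) p.608] -/
theorem rtKernelStep_nonneg (C : ChargeData N) {a : ℝ} (ha : 0 < a) (A : VecField P 0) (ψ : ScalarField P (k + 1) N)
    (φ : ScalarField P k N) : 0 ≤ rtKernelStep C a A ψ φ :=
  blockKernel_nonneg (prec_step_pos (P := P) (k := k) ha).le _ _ _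

/-- The scalar-field kernel (2.5)–(2.6) is bounded by `((κ/2π)^{N/2})^{|T^{(k+1)}|}`. [cite: Balaban1982Higgs1, (2.6) p.608] -/
theorem rtKernelStep_le (C : ChargeData N) {a : ℝ} (ha : 0 < a) (A : VecField P 0) (ψ : ScalarField P (k + 1) N)
    (φ : ScalarField P k N) : rtKernelStep C a A ψ φ ≤ kernelBound P k N a := by
  have h := blockKernel_le (prec_step_pos (P := P) (k := k) ha).le (avgQ (P := P) (k := k) C A) ψ φ
  rw [finrank_euclideanSpace_fin] at h
  exact h

/-- **The kernel of the vector-field transformation `T^{L^kε}_{a,L}`** at level `k`, p. 608: *"taking N = d and an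
external vector field A = 0"* in (2.5)–(2.6) — the scalar-field kernel `HiggsAveraging.rtKernelStep` with `N = d` at the
external field `0` (so that every transport is `U(0) = 1` and `Q(0)` is the plain block average, `avgQ_zero_apply`; the
charge matrix being immaterial, `B3MultiscaleFields.zeroCharge d` is taken), evaluated on the site functions
`x ↦ (B_μ(x))_μ`, `x ↦ (A_μ(x))_μ`: `Π_{y ∈ T^{(k+1)}} (a(L^{k+1}ε)^{d−2}/2π)^{d/2} exp(−½a(L^{k+1}ε)^{d−2}|B(y) − (QA)(y)|²)`.
[cite: Balaban1982Higgs1, (2.5)–(2.6) p.608] -/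
noncomputable def vecKernel (a : ℝ) (B : VecField P (k + 1)) (A : VecField P k) : ℝ :=
  rtKernelStep (k := k) (zeroCharge P.d) a (0 : VecField P 0) (toSite B) (toSite A)

/-- Unfolding: the vector-field kernel is the block kernel (2.5) at the plain average of `(A_μ(·))_μ`.
[cite: Balaban1982Higgs1, (2.5) p.608] -/
theorem vecKernel_eq (a : ℝ) (B : VecField P (k + 1)) (A : VecField P k) :
    vecKernel a B A = blockKernel (prec a (P.mesh (k + 1)) P.d)
      (avgQ (k := k) (zeroCharge P.d) (0 : VecField P 0)) (toSite B) (toSite A) := rfl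

/-- The vector-field kernel is non-negative. [cite: Balaban1982Higgs1, (2.5) p.608] -/
theorem vecKernel_nonneg {a : ℝ} (ha : 0 < a) (B : VecField P (k + 1)) (A : VecField P k) : 0 ≤ vecKernel a B A :=
  rtKernelStep_nonneg _ ha _ _ _

/-- The vector-field kernel is bounded by `((κ/2π)^{d/2})^{|T^{(k+1)}|}`. [cite: Balaban1982Higgs1, (2.5) p.608] -/
theorem vecKernel_le {a : ℝ} (ha : 0 < a) (B : VecField P (k + 1)) (A : VecField P k) :
    vecKernel a B A ≤ kernelBound P k P.d a :=
  rtKernelStep_le _ ha _ _ _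

/-- **(2.8) for the vector-field transformation**: `∫dB t_{a,L}(B, A) = 1` — by the change of variables
`measurePreserving_toSite` this IS the scalar-field normalization `HiggsAveraging.integral_rtKernelStep` with `N = d`
(p. 608). PROVED. [cite: Balaban1982Higgs1, (2.8) p.609] -/
theorem integral_vecKernel {a : ℝ} (ha : 0 < a) (A : VecField P k) :
    ∫ B : VecField P (k + 1), vecKernel a B A = 1 := by
  have h := integral_comp_toSite (P := P) (k := k + 1)
    (fun ψ : ScalarField P (k + 1) P.d => rtKernelStep (k := k) (zeroCharge P.d) a (0 : VecField P 0) ψ (toSite A))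
  have h1 : ∫ ψ : ScalarField P (k + 1) P.d,
      rtKernelStep (k := k) (zeroCharge P.d) a (0 : VecField P 0) ψ (toSite A) = 1 :=
    integral_rtKernelStep (zeroCharge P.d) ha _ _
  rw [h1] at h
  exact h

/-- The vector-field kernel is jointly continuous in `(B, A)`. [cite: Balaban1982Higgs1, (2.5) p.608] -/
theorem continuous_vecKernel (a : ℝ) : Continuous (Function.uncurry (vecKernel (P := P) (k := k) a)) := by
  have h := continuous_rtKernelStep_comp (P := P) (k := k) (zeroCharge P.d) a
    (continuous_const : Continuous fun _ : VecField P (k + 1) × VecField P k => (0 : VecField P 0))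
    (continuous_toSite.comp continuous_fst) (continuous_toSite.comp continuous_snd)
  exact h

end Kernels

/-! ## 6. The double transformation at level `k` -/

section Double

variable {k N : ℕ}

/-- **The double renormalization transformation at level `k`** with the scalar-field transformation at the external
`ε`-lattice field `Ã(A)`: `T^{L^kε}_{a,L}[T^{L^kε}_{a,L,Ã(A)}[ρ]](B, ψ) = ∫dA t_{a,L}(B, A) (T^{L^kε}_{a,L,Ã(A)}ρ(A,·))(ψ)`
= `∫dA t_{a,L}(B, A) ∫dφ t_{a,L,Ã(A)}(ψ, φ) ρ(A, φ)` ((2.4) twice; (3.6) p. 613: `k = 0`, `Ã(A) = A`; (3.37) p. 618: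
`Ã(A) = A^{(k),ε}`). [cite: Balaban1982Higgs1, (2.4) p.608, (3.37) p.618] -/
noncomputable def doubleRTk (C : ChargeData N) (a : ℝ) (ext : VecField P k → VecField P 0)
    (ρ : VecField P k → ScalarField P k N → ℝ) (B : VecField P (k + 1)) (ψ : ScalarField P (k + 1) N) : ℝ :=
  ∫ A : VecField P k, vecKernel a B A * renormTransf C a (ext A) (ρ A) ψ

/-- `doubleRTk` in the iterated-kernel form of `B1Ineq36LowerStep.doubleKernel_iterated` (definitional).
[cite: Balaban1982Higgs1, (2.4) p.608] -/
theorem doubleRTk_eq (C : ChargeData N) (a : ℝ) (ext : VecField P k → VecField P 0)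
    (ρ : VecField P k → ScalarField P k N → ℝ) (B : VecField P (k + 1)) (ψ : ScalarField P (k + 1) N) :
    doubleRTk C a ext ρ B ψ
      = ∫ A : VecField P k, vecKernel a B A * ∫ φ : ScalarField P k N, rtKernelStep C a (ext A) ψ φ * ρ A φ :=
  rfl

/-- The product kernel of the double transformation is bounded. [cite: Balaban1982Higgs1, (3.6) p.613] -/
theorem doubleKernel_le {a : ℝ} (ha : 0 < a) (C : ChargeData N) (ext : VecField P k → VecField P 0)
    (bψ : VecField P (k + 1) × ScalarField P (k + 1) N) (aφ : VecField P k × ScalarField P k N) :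
    doubleKernel (vecKernel a) (fun A => rtKernelStep (k := k) C a (ext A)) bψ aφ ≤ kernelBound P k P.d a * kernelBound P k N a := by
  rw [doubleKernel_apply]
  exact mul_le_mul (vecKernel_le ha _ _) (rtKernelStep_le C ha _ _ _) (rtKernelStep_nonneg C ha _ _ _)
    (kernelBound_nonneg P.d ha)

/-- The product kernel of the double transformation is non-negative. [cite: Balaban1982Higgs1, (3.6) p.613] -/
theorem doubleKernel_model_nonneg {a : ℝ} (ha : 0 < a) (C : ChargeData N) (ext : VecField P k → VecField P 0)
    (bψ : VecField P (k + 1) × ScalarField P (k + 1) N) (aφ : VecField P k × ScalarField P k N) :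
    0 ≤ doubleKernel (vecKernel a) (fun A => rtKernelStep (k := k) C a (ext A)) bψ aφ :=
  doubleKernel_nonneg (vecKernel_nonneg ha) (fun A => rtKernelStep_nonneg C ha (ext A)) bψ aφ

/-- The product kernel of the double transformation is jointly measurable (external field measurable in `A`).
[cite: Balaban1982Higgs1, (3.6) p.613] -/
theorem measurable_doubleKernel_model (a : ℝ) (C : ChargeData N) {ext : VecField P k → VecField P 0}
    (hext : Measurable ext) :
    Measurable (Function.uncurry (doubleKernel (vecKernel a) (fun A => rtKernelStep (k := k) C a (ext A)))) :=
  measurable_doubleKernel (continuous_vecKernel a).measurable (measurable_rtKernelStep_ext C a hext)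

/-- Integrability of the joint integrand of the double transformation against an integrable density (bounded
measurable kernel × integrable density) — the hypothesis of `B1Ineq36LowerStep.doubleKernel_iterated`.
[cite: Balaban1982Higgs1, (3.6) p.613] -/
theorem integrable_doubleKernel_mul {a : ℝ} (ha : 0 < a) (C : ChargeData N) {ext : VecField P k → VecField P 0}
    (hext : Measurable ext) {ρ : VecField P k × ScalarField P k N → ℝ}
    (hρ : Integrable ρ ((volume : Measure (VecField P k)).prod (volume : Measure (ScalarField P k N))))
    (bψ : VecField P (k + 1) × ScalarField P (k + 1) N) :
    Integrable (fun aφ => doubleKernel (vecKernel a) (fun A => rtKernelStep (k := k) C a (ext A)) bψ aφ * ρ aφ)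
      ((volume : Measure (VecField P k)).prod (volume : Measure (ScalarField P k N))) := by
  have hm : Measurable (doubleKernel (vecKernel a) (fun A => rtKernelStep (k := k) C a (ext A)) bψ) :=
    (measurable_doubleKernel_model a C hext).of_uncurry_left
  have hb : ∀ aφ : VecField P k × ScalarField P k N,
      ‖doubleKernel (vecKernel a) (fun A => rtKernelStep (k := k) C a (ext A)) bψ aφ‖ ≤ kernelBound P k P.d a * kernelBound P k N a := by
    intro aφ
    rw [Real.norm_of_nonneg (doubleKernel_model_nonneg ha C ext bψ aφ)]
    exact doubleKernel_le ha C ext bψ aφ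
  exact Integrable.bdd_mul (c := kernelBound P k P.d a * kernelBound P k N a) hρ hm.aestronglyMeasurable
    (Filter.Eventually.of_forall hb)

/-- `doubleRTk` IS the one-product-kernel form of `B1Ineq36LowerStep` for every integrable density (Fubini).
[cite: Balaban1982Higgs1, (3.6) p.613] -/
theorem doubleRTk_eq_integral_doubleKernel {a : ℝ} (ha : 0 < a) (C : ChargeData N) {ext : VecField P k → VecField P 0}
    (hext : Measurable ext) {ρ : VecField P k → ScalarField P k N → ℝ}
    (hρ : Integrable (Function.uncurry ρ) ((volume : Measure (VecField P k)).prod (volume : Measure (ScalarField P k N))))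
    (bψ : VecField P (k + 1) × ScalarField P (k + 1) N) :
    doubleRTk C a ext ρ bψ.1 bψ.2
      = ∫ aφ, doubleKernel (vecKernel a) (fun A => rtKernelStep (k := k) C a (ext A)) bψ aφ * Function.uncurry ρ aφ
          ∂((volume : Measure (VecField P k)).prod (volume : Measure (ScalarField P k N))) := by
  rw [doubleKernel_iterated _ _ _ bψ (integrable_doubleKernel_mul ha C hext hρ bψ), doubleRTk_eq]
  rfl

/-- **(2.9) for the double transformation**: `∫dB∫dψ T^{L^kε}_{a,L}[T^{L^kε}_{a,L,Ã(A)}[ρ]](B, ψ) = ∫dA∫dφ ρ(A, φ)` for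
every integrable density `ρ` and every measurable external-field assignment `Ã`. PROVED (r14's
`integral_integral_kernel_mul` with its hypotheses discharged by §5). [cite: Balaban1982Higgs1, (2.9) p.609] -/
theorem integral_doubleRTk {a : ℝ} (ha : 0 < a) (C : ChargeData N) {ext : VecField P k → VecField P 0}
    (hext : Measurable ext) {ρ : VecField P k → ScalarField P k N → ℝ}
    (hρ : Integrable fun Φ : VecField P k × ScalarField P k N => ρ Φ.1 Φ.2) :
    ∫ Ψ : VecField P (k + 1) × ScalarField P (k + 1) N, doubleRTk C a ext ρ Ψ.1 Ψ.2
      = ∫ Φ : VecField P k × ScalarField P k N, ρ Φ.1 Φ.2 := by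
  have hρ' : Integrable (Function.uncurry ρ)
      ((volume : Measure (VecField P k)).prod (volume : Measure (ScalarField P k N))) := by
    rw [← Measure.volume_eq_prod]
    exact hρ
  rw [Measure.volume_eq_prod, Measure.volume_eq_prod]
  simp_rw [doubleRTk_eq_integral_doubleKernel ha C hext hρ']
  exact integral_integral_kernel_mul (measurable_doubleKernel_model a C hext) (doubleKernel_model_nonneg ha C ext)
    (integral_doubleKernel (integral_vecKernel ha) fun A => integral_rtKernelStep C ha (ext A)) hρ'

/-- The double transformation of a non-negative density is non-negative. [cite: Balaban1982Higgs1, (2.4) p.608] -/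
theorem doubleRTk_nonneg {a : ℝ} (ha : 0 < a) (C : ChargeData N) (ext : VecField P k → VecField P 0)
    {ρ : VecField P k → ScalarField P k N → ℝ} (hρ0 : ∀ A φ, 0 ≤ ρ A φ) (B : VecField P (k + 1))
    (ψ : ScalarField P (k + 1) N) : 0 ≤ doubleRTk C a ext ρ B ψ :=
  integral_nonneg fun A => mul_nonneg (vecKernel_nonneg ha B A)
    (integral_nonneg fun φ => mul_nonneg (rtKernelStep_nonneg C ha (ext A) ψ φ) (hρ0 A φ))

/-- The double transformation of an integrable density is integrable (`dB dψ`). [cite: Balaban1982Higgs1, (2.9) p.609] -/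
theorem integrable_doubleRTk {a : ℝ} (ha : 0 < a) (C : ChargeData N) {ext : VecField P k → VecField P 0}
    (hext : Measurable ext) {ρ : VecField P k → ScalarField P k N → ℝ}
    (hρ : Integrable fun Φ : VecField P k × ScalarField P k N => ρ Φ.1 Φ.2) :
    Integrable fun Ψ : VecField P (k + 1) × ScalarField P (k + 1) N => doubleRTk C a ext ρ Ψ.1 Ψ.2 := by
  have hρ' : Integrable (Function.uncurry ρ)
      ((volume : Measure (VecField P k)).prod (volume : Measure (ScalarField P k N))) := by
    rw [← Measure.volume_eq_prod]
    exact hρ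
  have h := integrable_integral_kernel_mul (measurable_doubleKernel_model a C hext) (doubleKernel_model_nonneg ha C ext)
    (integral_doubleKernel (ν₁ := (volume : Measure (VecField P (k + 1))))
      (ν₂ := (volume : Measure (ScalarField P (k + 1) N)))
      (integral_vecKernel ha) fun A => integral_rtKernelStep C ha (ext A)) hρ'
  rw [← Measure.volume_eq_prod] at h
  refine h.congr (Filter.Eventually.of_forall fun Ψ => ?_)
  exact (doubleRTk_eq_integral_doubleKernel ha C hext hρ' Ψ).symm

/-- **The step "(2.9) ⇒ (3.37)"** (p. 618, *"From (3.26) and (2.9) we have (3.37)"*): inserting a weight `0 ≤ χ′ ≤ 1`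
(↤ `χ_{k+1}(B)χ_{k+1}(ψ)`) against the double transformation of a non-negative integrable density only decreases the
integral: `∫dB∫dψ χ′(B, ψ)·T[T[ρ]](B, ψ) ≤ ∫dA∫dφ ρ(A, φ)`. PROVED. [cite: Balaban1982Higgs1, (3.37) p.618] -/
theorem integral_cutoff_doubleRTk_le {a : ℝ} (ha : 0 < a) (C : ChargeData N) {ext : VecField P k → VecField P 0}
    (hext : Measurable ext) {ρ : VecField P k → ScalarField P k N → ℝ}
    (hρ : Integrable fun Φ : VecField P k × ScalarField P k N => ρ Φ.1 Φ.2) (hρ0 : ∀ A φ, 0 ≤ ρ A φ)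
    {χ' : VecField P (k + 1) → ScalarField P (k + 1) N → ℝ} (c' : ∀ B ψ, χ' B ψ ∈ Set.Icc (0 : ℝ) 1) :
    ∫ Ψ : VecField P (k + 1) × ScalarField P (k + 1) N, χ' Ψ.1 Ψ.2 * doubleRTk C a ext ρ Ψ.1 Ψ.2
      ≤ ∫ Φ : VecField P k × ScalarField P k N, ρ Φ.1 Φ.2 := by
  rw [← integral_doubleRTk ha C hext hρ]
  exact integral_mono_of_nonneg
    (Filter.Eventually.of_forall fun Ψ => mul_nonneg (c' Ψ.1 Ψ.2).1 (doubleRTk_nonneg ha C ext hρ0 Ψ.1 Ψ.2))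
    (integrable_doubleRTk ha C hext hρ)
    (Filter.Eventually.of_forall fun Ψ => mul_le_of_le_one_left (doubleRTk_nonneg ha C ext hρ0 Ψ.1 Ψ.2) (c' Ψ.1 Ψ.2).2)

/-- **The shape of (3.6) p. 613 at level `k`, general weights**: for `a > 0`, a measurable external-field assignment
`Ã`, a non-negative integrable density `ρ(A, φ)` (↤ `exp(−S)`), and weights `0 ≤ χ₀(A, φ) ≤ 1` (jointly measurable),
`0 ≤ χ₁(B, ψ) ≤ 1`: `∫dB∫dψ χ₁ · T^{L^kε}_{a,L}[T^{L^kε}_{a,L,Ã(A)}[χ₀ρ]] ≤ ∫dA∫dφ ρ`.  PROVED: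
`B1Ineq36LowerStep.integral_cutoff_double_cutoff_le` with its eight kernel hypotheses discharged by §5.
[cite: Balaban1982Higgs1, (3.6) p.613] -/
theorem lowerStepK {a : ℝ} (ha : 0 < a) (C : ChargeData N) {ext : VecField P k → VecField P 0} (hext : Measurable ext)
    {ρ : VecField P k → ScalarField P k N → ℝ} (hρ : Integrable fun Φ : VecField P k × ScalarField P k N => ρ Φ.1 Φ.2)
    (hρ0 : ∀ A φ, 0 ≤ ρ A φ) {χ₀ : VecField P k → ScalarField P k N → ℝ}
    {χ₁ : VecField P (k + 1) → ScalarField P (k + 1) N → ℝ} (hχ₀ : Measurable (Function.uncurry χ₀))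
    (c₀ : ∀ A φ, χ₀ A φ ∈ Set.Icc (0 : ℝ) 1) (c₁ : ∀ B ψ, χ₁ B ψ ∈ Set.Icc (0 : ℝ) 1) :
    ∫ Ψ : VecField P (k + 1) × ScalarField P (k + 1) N,
        χ₁ Ψ.1 Ψ.2 * doubleRTk C a ext (fun A φ => χ₀ A φ * ρ A φ) Ψ.1 Ψ.2
      ≤ ∫ Φ : VecField P k × ScalarField P k N, ρ Φ.1 Φ.2 := by
  have hρ' : Integrable (fun aφ : VecField P k × ScalarField P k N => ρ aφ.1 aφ.2)
      ((volume : Measure (VecField P k)).prod (volume : Measure (ScalarField P k N))) := by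
    rw [← Measure.volume_eq_prod]
    exact hρ
  have hg : Integrable (Function.uncurry fun A φ => χ₀ A φ * ρ A φ)
      ((volume : Measure (VecField P k)).prod (volume : Measure (ScalarField P k N))) := by
    refine hρ'.bdd_mul (c := 1) hχ₀.aestronglyMeasurable (Filter.Eventually.of_forall fun aφ => ?_)
    change ‖χ₀ aφ.1 aφ.2‖ ≤ 1
    rw [Real.norm_of_nonneg (c₀ aφ.1 aφ.2).1]
    exact (c₀ aφ.1 aφ.2).2
  have key := integral_cutoff_double_cutoff_le
    (μ₁ := (volume : Measure (VecField P k))) (μ₂ := (volume : Measure (ScalarField P k N)))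
    (ν₁ := (volume : Measure (VecField P (k + 1)))) (ν₂ := (volume : Measure (ScalarField P (k + 1) N)))
    (χ₀ := Function.uncurry χ₀) (χ₁ := Function.uncurry χ₁)
    (continuous_vecKernel (P := P) (k := k) a).measurable (measurable_rtKernelStep_ext C a hext)
    (vecKernel_nonneg ha) (fun A => rtKernelStep_nonneg C ha (ext A)) (integral_vecKernel ha)
    (fun A => integral_rtKernelStep C ha (ext A)) hρ' (fun aφ => hρ0 aφ.1 aφ.2) hχ₀ (fun aφ => c₀ aφ.1 aφ.2)
    (fun bψ => c₁ bψ.1 bψ.2)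
  have hL : ∀ bψ : VecField P (k + 1) × ScalarField P (k + 1) N,
      χ₁ bψ.1 bψ.2 * doubleRTk C a ext (fun A φ => χ₀ A φ * ρ A φ) bψ.1 bψ.2
        = Function.uncurry χ₁ bψ * ∫ aφ, doubleKernel (vecKernel a) (fun A => rtKernelStep (k := k) C a (ext A)) bψ aφ
            * (Function.uncurry χ₀ aφ * ρ aφ.1 aφ.2)
            ∂((volume : Measure (VecField P k)).prod (volume : Measure (ScalarField P k N))) := by
    intro bψ
    rw [doubleRTk_eq_integral_doubleKernel ha C hext hg bψ]
    rfl
  calc ∫ Ψ : VecField P (k + 1) × ScalarField P (k + 1) N,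
        χ₁ Ψ.1 Ψ.2 * doubleRTk C a ext (fun A φ => χ₀ A φ * ρ A φ) Ψ.1 Ψ.2
      = ∫ bψ, Function.uncurry χ₁ bψ * ∫ aφ, doubleKernel (vecKernel a) (fun A => rtKernelStep (k := k) C a (ext A)) bψ aφ
            * (Function.uncurry χ₀ aφ * ρ aφ.1 aφ.2)
            ∂((volume : Measure (VecField P k)).prod (volume : Measure (ScalarField P k N)))
          ∂((volume : Measure (VecField P (k + 1))).prod (volume : Measure (ScalarField P (k + 1) N))) := by
        rw [Measure.volume_eq_prod]
        exact integral_congr_ae (Filter.Eventually.of_forall hL)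
    _ ≤ ∫ aφ, ρ aφ.1 aφ.2 ∂((volume : Measure (VecField P k)).prod (volume : Measure (ScalarField P k N))) := key
    _ = ∫ Φ : VecField P k × ScalarField P k N, ρ Φ.1 Φ.2 := by rw [Measure.volume_eq_prod]

/-- `lowerStepK` for a density `exp(−S(A, φ))` (↤ `exp(−S^ε)` in (3.6), `exp(−S^{(k),L^kε})` in (3.37)) — only the
integrability of `exp(−S)` is needed. [cite: Balaban1982Higgs1, (3.6) p.613] -/
theorem lowerStepK_exp {a : ℝ} (ha : 0 < a) (C : ChargeData N) {ext : VecField P k → VecField P 0}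
    (hext : Measurable ext) {S : VecField P k → ScalarField P k N → ℝ}
    (hS : Integrable fun Φ : VecField P k × ScalarField P k N => Real.exp (-S Φ.1 Φ.2))
    {χ₀ : VecField P k → ScalarField P k N → ℝ} {χ₁ : VecField P (k + 1) → ScalarField P (k + 1) N → ℝ}
    (hχ₀ : Measurable (Function.uncurry χ₀)) (c₀ : ∀ A φ, χ₀ A φ ∈ Set.Icc (0 : ℝ) 1)
    (c₁ : ∀ B ψ, χ₁ B ψ ∈ Set.Icc (0 : ℝ) 1) :
    ∫ Ψ : VecField P (k + 1) × ScalarField P (k + 1) N,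
        χ₁ Ψ.1 Ψ.2 * doubleRTk C a ext (fun A φ => χ₀ A φ * Real.exp (-S A φ)) Ψ.1 Ψ.2
      ≤ ∫ Φ : VecField P k × ScalarField P k N, Real.exp (-S Φ.1 Φ.2) :=
  lowerStepK ha C hext (ρ := fun A φ => Real.exp (-S A φ)) hS (fun _ _ => (Real.exp_pos _).le) hχ₀ c₀ c₁

end Double

end Literature.MathematicalPhysics.QuantumFieldTheory.Balaban1983to89.HiggsDoubleRT
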